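import Mathlib
import Summits.KontsevichZagierPeriods.Zeta5Search.BrickDigitSide
import Summits.KontsevichZagierPeriods.Zeta5Search.BrickHarmonicBlocks
import Summits.KontsevichZagierPeriods.Zeta5Search.BrickPartialFractions
import Summits.KontsevichZagierPeriods.Zeta5Search.BrickDigitStepDZero

/-!
# BrickDigitSideZero — THEOREM 6 for the CONSTANT-TERM CELL `s = 0`, DIGIT SIDE: Step E
(`p^A·cell^{(0)}_j(n) ≡ c_{j₀,A}(n₀)·cell̃^{(0)}_{j₁}(n₁) (mod p)`), Step F (`Σ_{j≤n} q_n(j)·p^A·cell^{(0)}_j(n) ≡ 0 (mod p)`)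
and the digit side `Σ_{j=0}^{n} D_j^{(0)} ≡ 0 (mod p³)` for every `n < p²` (cell zeta5-irr)

HONEST FRAMING: systematic search; no irrationality claim unless certified. INSTRUMENT theorem of the ζ(5)
census cell zeta5-irr (HOME `run/shared/lean/pub/zeta5-irr/`; memo `zi-p2/probes/B8/thm6/THEOREM6.md` Steps E/F and
§1 Addendum read for the harmonic cell: `cell^{(0)}_j(n) = −Σ_{s=1}^{A} c_{j,s}(n)H_j^{(s)}`, `p^s H_j^{(s)} ≡ H_{j₁}^{(s)}
(mod p)` (the blocks of (B2) and the tail `Σ_{r ≤ j₀}(j₁p + r)^{−s}` are `p`-integral), so (E1⁺) for every `s ≥ 1`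
gives (E1⁺)₀, Step F's index decomposition gives (F5)₀ verbatim, and (D2) + LEMMA Φ4 + Wolstenholme give the digit
side). Nothing here is about ζ(5); no irrationality content; filing moves no rung (zi-p2's THEOREM 6 is a certified
instrument-tier statement; this file puts the digit half of its harmonic cell in the kernel). Filed by the engine
seat zi-eng (g8): assembly of `BrickTwoDigitAll.cell_two_digit_all` ((E1⁺)), `BrickHarmonicBlocks.pow_mul_hsum_mul`
((B2) exact), `BrickStepF` ((F1), (F4), index decomposition), `BrickDigitStepDZero.digitDZero_sub_le` ((D2)),
`BrickPhiFour` (LEMMA Φ4, Wolstenholme).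

## The statements

`p` an odd prime (`p ≥ 5` for Step F and the digit side), `A` even, `2 ≤ 2B ≤ A`, `j ≤ n < p²`, `n = n₀ + n₁p`,
`j = j₀ + j₁p` (digits), `hsum s K = H_K^{(s)}`, `cellZero A B ε n K = −Σ_{s=1}^{A} cell A B ε n K s · H_K^{(s)}`
(`BrickPartialFractions`), `digitDZero A B p 1 n j = p^{A−1}(p^{A−1}cellZero(np, jp) − cellZero(n, j))`:

* `pow_mul_hsum_sub_lt`: `v(p^s·H_j^{(s)} − H_{j₁}^{(s)}) < 1` (`s ≥ 1`);
* `cellZero_two_digit_all` ((E1⁺)₀): **`v(p^A·cellZero A B 1 n j − cTop A B 1 n₀ j₀ · cellZero A B 0 n₁ j₁) < 1`**;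
* `stepFZero` ((F5)₀): **`v(Σ_{j=0}^{n} q_n(j)·p^A·cellZero A B 1 n j) < 1`**, `q_n(j) = BrickPhiFour.phiMoment A B n j`;
* `sum_digitDZero_le` (digit side): **`v(Σ_{j=0}^{n} digitDZero A B p 1 n j) ≤ exp(−3)`**.
-/
namespace Summit.KontsevichZagierPeriods.Zeta5Search.BrickDigitSideZero

open Finset Nat WithZero
open Summit.KontsevichZagierPeriods.Zeta5Search.BrickTopCoefficient (cTop)
open Summit.KontsevichZagierPeriods.Zeta5Search.BrickPhiFour (phiMoment)
open Summit.KontsevichZagierPeriods.Zeta5Search.BrickLaurent (cell)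
open Summit.KontsevichZagierPeriods.Zeta5Search.BrickPartialFractions (cellZero)
open Summit.KontsevichZagierPeriods.Zeta5Search.BrickHarmonicBlocks (hsum blockSigma hsum_add pow_mul_hsum_mul
  padicValuation_blockSigma_le_one)
open Summit.KontsevichZagierPeriods.Zeta5Search.BrickTopKummer (cell_one_valuation_abs cell_integral_of_lt)
open Summit.KontsevichZagierPeriods.Zeta5Search.BrickTwoDigitAll (cell_two_digit_all padicValuation_cTop_one
  padicValuation_centre_le_one)
open Summit.KontsevichZagierPeriods.Zeta5Search.BrickLambda (cong_mul)
open Summit.KontsevichZagierPeriods.Zeta5Search.BrickStepF (phiMoment_sub_lt sum_mod_div_eq_zero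
  sum_phiMoment_mul_cTop)
open Summit.KontsevichZagierPeriods.Zeta5Search.BrickDigitStepDZero (cellZero_eq digitDZero digitDZero_sub_le
  hsum_valuation)
open Summit.KontsevichZagierPeriods.Zeta5Search.BrickKernelFrobenius (brickPhi)
open Summit.KontsevichZagierPeriods.Zeta5Search.BrickPhiFour (padicValuation_brickPhi_sub_le
  padicValuation_prime_mul_harmonic_le)
open Summit.KontsevichZagierPeriods.Zeta5Search.BrickLaurent (phiCoeff phiCoeff_zero)
open Summit.KontsevichZagierPeriods.Zeta5Search.BrickDigitSide (le_exp_neg_one_of_lt_one)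
open Literature.NumberTheory.LFunctions (padicValuation_natCast_le_one padicValuation_natCast_eq_one)

noncomputable section

variable {p : ℕ} [Fact p.Prime]

/-! ## The harmonic factor: `p^s·H_j^{(s)} ≡ H_{j₁}^{(s)} (mod p)` -/

/-- `H_J^{(s)}` is `p`-integral for `J < p`. -/
theorem hsum_integral_of_lt {J : ℕ} (hJ : J < p) (s : ℕ) : Rat.padicValuation p (hsum s J) ≤ 1 := by
  refine Valuation.map_sum_le _ fun i hi => ?_
  have hi' := mem_Icc.1 hi
  rw [one_div, map_inv₀, map_pow, padicValuation_natCast_eq_one (fun h => ?_), one_pow, inv_one]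
  exact absurd (Nat.le_of_dvd (by omega) h) (by omega)

/-- **`p^s·H_j^{(s)} ≡ H_{⌊j/p⌋}^{(s)} (mod p)`** for `s ≥ 1`: `v(p^s·hsum s j − hsum s (j / p)) < 1`. -/
theorem pow_mul_hsum_sub_lt {s : ℕ} (hs : 1 ≤ s) (j : ℕ) :
    Rat.padicValuation p ((p : ℚ) ^ s * hsum s j - hsum s (j / p)) < 1 := by
  have hp : p.Prime := Fact.out
  have hps : Rat.padicValuation p ((p : ℚ) ^ s) = exp (-(s : ℤ)) := by
    rw [map_pow, Rat.padicValuation_self, ← exp_nsmul, nsmul_eq_mul, mul_neg_one]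
  have hlt : exp (-(s : ℤ)) < 1 := by rw [← exp_zero, exp_lt_exp]; omega
  rw [show hsum s j = hsum s (j / p * p + j % p) by rw [Nat.div_add_mod'], hsum_add, mul_add, pow_mul_hsum_mul,
    add_assoc, add_sub_cancel_left]
  refine Valuation.map_add_lt _ ?_ ?_
  · rw [map_mul, hps]
    refine (mul_le_mul' le_rfl (Valuation.map_sum_le _ fun b _ => padicValuation_blockSigma_le_one s b)).trans_lt ?_
    rwa [mul_one]
  · rw [map_mul, hps]
    refine (mul_le_mul' le_rfl (Valuation.map_sum_le _ fun r hr => ?_)).trans_lt (by rwa [mul_one])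
    have hr' := mem_Icc.1 hr
    have hjp := Nat.mod_lt j hp.pos
    rw [one_div, map_inv₀, map_pow, padicValuation_natCast_eq_one (fun h => ?_), one_pow, inv_one]
    have : p ∣ r := (Nat.dvd_add_right (dvd_mul_left p (j / p))).1 h
    exact absurd (Nat.le_of_dvd (by omega) this) (by omega)

/-! ## (E1⁺)₀ -/

/-- `p^{A−s}·c_{j,s}(n)` is `p`-integral for `j ≤ n < p²` ((C3⁺) at level 1). -/
theorem pow_mul_cell_le_one (hp2 : p ≠ 2) {A B n j : ℕ} (hAB : 2 * B ≤ A) (hn : n < p ^ 2) (hj : j ≤ n) (s : ℕ) :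
    Rat.padicValuation p ((p : ℚ) ^ (A - s) * cell A B 1 n j s) ≤ 1 := by
  rw [map_mul, map_pow, Rat.padicValuation_self, ← exp_nsmul, nsmul_eq_mul, mul_neg_one]
  refine (mul_le_mul' le_rfl (cell_one_valuation_abs hp2 hAB (L := 1) (by simpa using hn) hj s)).trans ?_
  rw [← exp_add, ← exp_zero, exp_le_exp]
  simp

/-- The one-digit harmonic cell `cell̃^{(0)}_J(N)` (`ε = 0`, `J ≤ N < p`) is `p`-integral. -/
theorem cellZero_integral_of_lt (hp2 : p ≠ 2) {A B N J : ℕ} (hAB : 2 * B ≤ A) (hN : N < p) (hJN : J ≤ N) :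
    Rat.padicValuation p (cellZero A B 0 N J) ≤ 1 := by
  rw [cellZero_eq, Valuation.map_neg]
  refine Valuation.map_sum_le _ fun s _ => ?_
  rw [map_mul]
  exact mul_le_one' (cell_integral_of_lt hp2 hAB hN hJN (Or.inr rfl) s) (hsum_integral_of_lt (by omega) s)

/-- **(E1⁺)₀ — the two-digit congruence for the harmonic cell, ALL `j ≤ n < p²`**:
`p^A·cell^{(0)}_j(n) ≡ c_{j₀,A}(n₀)·cell̃^{(0)}_{j₁}(n₁) (mod p)`. -/
theorem cellZero_two_digit_all (hp2 : p ≠ 2) {A B n j : ℕ} (hAB : 2 * B ≤ A) (hB : 1 ≤ B) (hn : n < p ^ 2)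
    (hj : j ≤ n) :
    Rat.padicValuation p ((p : ℚ) ^ A * cellZero A B 1 n j -
      cTop A B 1 (n % p) (j % p) * cellZero A B 0 (n / p) (j / p)) < 1 := by
  have hp : p.Prime := Fact.out
  have hJ : j / p < p := Nat.div_lt_of_lt_mul (by rw [← pow_two]; exact lt_of_le_of_lt hj hn)
  rw [cellZero_eq, cellZero_eq, mul_neg, mul_neg, neg_sub_neg, Finset.mul_sum, Finset.mul_sum,
    ← Finset.sum_sub_distrib]
  refine Valuation.map_sum_lt _ one_ne_zero fun s hs => ?_
  have hs' := mem_Icc.1 hs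
  rw [Valuation.map_sub_swap, show (p : ℚ) ^ A * (cell A B 1 n j s * hsum s j) =
      ((p : ℚ) ^ (A - s) * cell A B 1 n j s) * ((p : ℚ) ^ s * hsum s j) by
    rw [mul_mul_mul_comm, ← pow_add, Nat.sub_add_cancel hs'.2], ← mul_assoc (cTop A B 1 (n % p) (j % p))]
  exact cong_mul (cell_two_digit_all hp2 hAB hB hn hj s) (pow_mul_hsum_sub_lt hs'.1 j)
    (pow_mul_cell_le_one hp2 hAB hn hj s) (hsum_integral_of_lt hJ s)

/-! ## (F5)₀ -/

/-- **STEP F for the harmonic cell**: for `p ≥ 5`, `A` even, `2 ≤ 2B ≤ A`, `n < p²`: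
`v_p(Σ_{j=0}^{n} q_n(j)·p^A·cell^{(0)}_j(n)) ≥ 1`. -/
theorem stepFZero (h3 : 3 < p) {A B n : ℕ} (hA : Even A) (hAB : 2 * B ≤ A) (hB : 1 ≤ B) (hn : n < p ^ 2) :
    Rat.padicValuation p (∑ j ∈ range (n + 1),
      (phiMoment A B n ((j : ℕ) : ℤ) : ℚ) * ((p : ℚ) ^ A * cellZero A B 1 n j)) < 1 := by
  have hp : p.Prime := Fact.out
  have hp2 : p ≠ 2 := by omega
  have hp3 : p ≠ 3 := by omega
  have hN : n / p < p := Nat.div_lt_of_lt_mul (by rw [← pow_two]; exact hn)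
  -- the model terms `q_{n₀}(j₀)·c_{j₀,A}(n₀)·cell̃^{(0)}_{j₁}(n₁)` sum to zero exactly
  set f : ℕ → ℚ := fun j₀ => (phiMoment A B (n % p) ((j₀ : ℕ) : ℤ) : ℚ) * cTop A B 1 (n % p) j₀ with hf
  set g : ℕ → ℚ := fun j₁ => cellZero A B 0 (n / p) j₁ with hg
  have hzero : ∑ j ∈ range (n + 1), f (j % p) * g (j / p) = 0 := by
    refine sum_mod_div_eq_zero (fun i hi => ?_) (sum_phiMoment_mul_cTop hA hAB (n % p))
    simp only [hf, cTop, Nat.choose_eq_zero_of_lt hi, Nat.cast_zero, zero_pow (by omega : A ≠ 0), mul_zero, zero_mul]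
  -- termwise congruence
  have hterm : ∀ j ∈ range (n + 1), Rat.padicValuation p
      ((phiMoment A B n ((j : ℕ) : ℤ) : ℚ) * ((p : ℚ) ^ A * cellZero A B 1 n j) - f (j % p) * g (j / p)) < 1 := by
    intro j hj
    have hjn : j ≤ n := by have := mem_range.1 hj; omega
    have hJN : j / p ≤ n / p := Nat.div_le_div_right hjn
    rw [hf, hg]
    simp only
    rw [mul_assoc]
    have hq : Rat.padicValuation p ((phiMoment A B n ((j : ℕ) : ℤ) : ℚ)) ≤ 1 := by
      rw [Rat.padicValuation_cast]; exact Int.padicValuation_le_one _ _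
    have hR : Rat.padicValuation p (cTop A B 1 (n % p) (j % p) * cellZero A B 0 (n / p) (j / p)) ≤ 1 := by
      rw [map_mul]
      refine mul_le_one' ?_ (cellZero_integral_of_lt hp2 hAB hN hJN)
      rw [padicValuation_cTop_one]
      exact mul_le_one' (mul_le_one' (padicValuation_centre_le_one hp2 _ _)
        (pow_le_one' (padicValuation_natCast_le_one _) _))
        (pow_le_one' (mul_le_one' (padicValuation_natCast_le_one _) (padicValuation_natCast_le_one _)) _)
    exact cong_mul (phiMoment_sub_lt hp3 hAB n j) (cellZero_two_digit_all hp2 hAB hB hn hjn) hq hR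
  -- sum up
  have hdiff : Rat.padicValuation p (∑ j ∈ range (n + 1),
      ((phiMoment A B n ((j : ℕ) : ℤ) : ℚ) * ((p : ℚ) ^ A * cellZero A B 1 n j) - f (j % p) * g (j / p))) < 1 :=
    Valuation.map_sum_lt _ one_ne_zero hterm
  rwa [Finset.sum_sub_distrib, hzero, sub_zero] at hdiff

/-! ## The digit side for the harmonic cell -/

/-- `v(cell^{(0)}_j(n)) ≥ −L·A` for `j ≤ n < p^{L+1}` ((C3⁺) and `v(H_j^{(s)}) ≥ −Ls`). -/
theorem cellZero_one_valuation_abs (hp2 : p ≠ 2) {A B L n j : ℕ} (hAB : 2 * B ≤ A) (hn : n < p ^ (L + 1))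
    (hj : j ≤ n) : Rat.padicValuation p (cellZero A B 1 n j) ≤ exp ((L : ℤ) * A) := by
  rw [cellZero_eq, Valuation.map_neg]
  refine Valuation.map_sum_le _ fun s hs => ?_
  have hs' := mem_Icc.1 hs
  rw [map_mul]
  refine (mul_le_mul' (cell_one_valuation_abs hp2 hAB hn hj s) (hsum_valuation (lt_of_le_of_lt hj hn) s)).trans ?_
  rw [← exp_add, exp_le_exp, Nat.cast_sub hs'.2]
  nlinarith

/-- **THEOREM 6, DIGIT SIDE for the harmonic cell `s = 0`**: `p ≥ 5`, `A` even, `2 ≤ 2B ≤ A`, `n < p²` ⇒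
`v_p(Σ_{j=0}^{n} D_j^{(0)}) ≥ 3`. -/
theorem sum_digitDZero_le (h3 : 3 < p) {A B n : ℕ} (hA : Even A) (hAB : 2 * B ≤ A) (hB : 1 ≤ B) (hn : n < p ^ 2) :
    Rat.padicValuation p (∑ j ∈ range (n + 1), digitDZero A B p 1 n j) ≤ exp (-3) := by
  have hp : p.Prime := Fact.out
  have hp2 : p ≠ 2 := by omega
  have hA1 : 1 ≤ A := by omega
  set lam : ℚ := (p : ℚ) * harmonic (p - 1) with hlam
  set τ : ℕ := A - 1 with hτ
  have hpA : (p : ℚ) ^ A = (p : ℚ) ^ τ * p := by rw [hτ, ← pow_succ, Nat.sub_add_cancel hA1]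
  -- termwise: `D_j^{(0)} ≡ λ_p·p^τ·q_n(j)·cell^{(0)}_j(n) (mod p³)`
  have hterm : ∀ j ∈ range (n + 1), Rat.padicValuation p
      (digitDZero A B p 1 n j - lam * (p : ℚ) ^ τ * ((phiMoment A B n ((j : ℕ) : ℤ) : ℚ) * cellZero A B 1 n j))
        ≤ exp (-3) := by
    intro j hj
    have hjn : j ≤ n := by have := mem_range.1 hj; omega
    have hD := digitDZero_sub_le (p := p) h3 hAB hA1 (L := 1) (by simpa using hn) hjn
    rw [one_mul] at hD
    have hΦ := padicValuation_brickPhi_sub_le (p := p) h3 hAB n (j : ℤ)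
    rw [← phiCoeff_zero hp hp2 A B n (j : ℤ)] at hΦ
    have hc : Rat.padicValuation p ((p : ℚ) ^ τ * cellZero A B 1 n j) ≤ exp 1 := by
      rw [map_mul, map_pow, Rat.padicValuation_self, ← exp_nsmul]
      refine (mul_le_mul' le_rfl (cellZero_one_valuation_abs hp2 hAB (L := 1) (by simpa using hn) hjn)).trans ?_
      rw [← exp_add, exp_le_exp, hτ, nsmul_eq_mul, Nat.cast_sub hA1]
      push_cast
      linarith
    rw [show digitDZero A B p 1 n j - lam * (p : ℚ) ^ τ * ((phiMoment A B n ((j : ℕ) : ℤ) : ℚ) * cellZero A B 1 n j) =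
      (digitDZero A B p 1 n j - (p : ℚ) ^ (A - 1) * (phiCoeff A B p n j 0 - 1) * cellZero A B 1 n j) +
        (phiCoeff A B p n j 0 - 1 - lam * (phiMoment A B n ((j : ℕ) : ℤ) : ℚ)) * ((p : ℚ) ^ τ * cellZero A B 1 n j) by
      rw [hlam, hτ]; ring]
    refine (Valuation.map_add _ _ _).trans (max_le hD ?_)
    rw [map_mul]
    calc _ ≤ exp (-4) * exp 1 := mul_le_mul' hΦ hc
      _ = exp (-3) := by rw [← exp_add]; norm_num
  -- the model sum `λ_p·p^τ·Σ_j q_n(j)cell^{(0)}_j(n) = H_{p−1}·Σ_j q_n(j)·p^A·cell^{(0)}_j(n)` has valuation `≥ 2 + 1`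
  have hmodel : Rat.padicValuation p
      (∑ j ∈ range (n + 1), lam * (p : ℚ) ^ τ * ((phiMoment A B n ((j : ℕ) : ℤ) : ℚ) * cellZero A B 1 n j))
        ≤ exp (-3) := by
    have hrew : ∑ j ∈ range (n + 1), lam * (p : ℚ) ^ τ * ((phiMoment A B n ((j : ℕ) : ℤ) : ℚ) * cellZero A B 1 n j) =
        harmonic (p - 1) * ∑ j ∈ range (n + 1),
          (phiMoment A B n ((j : ℕ) : ℤ) : ℚ) * ((p : ℚ) ^ A * cellZero A B 1 n j) := by
      rw [Finset.mul_sum]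
      refine Finset.sum_congr rfl fun j _ => ?_
      rw [hlam, hpA]
      ring
    have hH : Rat.padicValuation p (harmonic (p - 1) : ℚ) ≤ exp (-2) := by
      have h := padicValuation_prime_mul_harmonic_le (p := p) h3
      rw [map_mul, Rat.padicValuation_self] at h
      calc Rat.padicValuation p (harmonic (p - 1) : ℚ)
          = exp 1 * (exp (-1) * Rat.padicValuation p (harmonic (p - 1) : ℚ)) := by
            rw [← mul_assoc, ← exp_add]; norm_num
        _ ≤ exp 1 * exp (-3) := mul_le_mul' le_rfl h
        _ = exp (-2) := by rw [← exp_add]; norm_num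
    rw [hrew, map_mul]
    calc _ ≤ exp (-2) * exp (-1) := mul_le_mul' hH (le_exp_neg_one_of_lt_one (stepFZero h3 hA hAB hB hn))
      _ = exp (-3) := by rw [← exp_add]; norm_num
  -- assemble
  have hsplit : ∑ j ∈ range (n + 1), digitDZero A B p 1 n j =
      ∑ j ∈ range (n + 1), (digitDZero A B p 1 n j -
        lam * (p : ℚ) ^ τ * ((phiMoment A B n ((j : ℕ) : ℤ) : ℚ) * cellZero A B 1 n j))
      + ∑ j ∈ range (n + 1), lam * (p : ℚ) ^ τ * ((phiMoment A B n ((j : ℕ) : ℤ) : ℚ) * cellZero A B 1 n j) := by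
    rw [← Finset.sum_add_distrib]; exact Finset.sum_congr rfl fun j _ => by ring
  rw [hsplit]
  exact (Valuation.map_add _ _ _).trans (max_le (Valuation.map_sum_le _ hterm) hmodel)

end

end Summit.KontsevichZagierPeriods.Zeta5Search.BrickDigitSideZero
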